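import Literature.AnabelianGeometry.SemiGraphs.PreimageComponentGluing
import HarnessLib

/-!
# The `B(𝒢_ℍ)`-sub-object attached to a component of `φ⁻¹(ℍ)` is CONNECTED ([SemiAnbd] §2, p. 30)

Mochizuki, *Semi-graphs of anabelioids*, Publ. RIMS **42** (2006), §2, proof of Corollary 2.7 (i),
p. 30: along the finite étale covering `𝒢′ → 𝒢` attached to `A ∈ B(𝒢)`, the restriction `ℋ′ → ℍ` to a
sub-semi-graph `ℍ` decomposes into "connected component[s] `ℋ″` of `ℋ′`", each again a (connected)
finite étale covering of `𝒢_ℍ` [cite: MochizukiSemiAnbd2006, Cor. 2.7(i) p.30].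

PROOF-ONLY (abc-iut cell, L3 row «D3a», brick M3a part 2, abc-iut-w5-d041, SECOND to abc-iut-L6-t17's
M1/M2): abc-iut-L6-t17's M2 (`PreimageComponentObject.lean`, `exists_preimageComponentObject`) attaches
to a preimage component `K` of `φ⁻¹(ℍ)` a sub-object `m : Z_K ↪ A|_ℍ` of `B(𝒢_ℍ)` whose fibre-image over
a vertex `w ∈ ℍ` (resp. edge `e ∈ ℍ`) is the union of the fibre-images of the components `cV w″`,
`w″ ∈ K` over `w` (resp. `cE e″`, `e″ ∈ K` over `e`).  THIS file proves, for ANY sub-object with these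
two fibre-image properties (so that it does not depend on the construction):

* `isConnected_of_preimageComponent_ranges` — **`Z_K` is a connected object of `B(𝒢_ℍ)`**.

The proof is the sheet argument of `GraphCoveringConnected.lean` (abc-iut-L6-t18) with "sheets"
replaced by "components" (tool-kit: `PreimageComponentGluing.lean`): for a monomorphism `W ↪ Z_K` the
predicate "the component `cV w″` (resp. `cE e″`) factors through `W`" is constant along the incidences
of the connected semi-graph `K` (`factors_iff_of_gluing_component`); if no component factors, `W` has
empty fibres and is initial; if all do, `W ↪ Z_K` is surjective on fibres, hence an isomorphism.  No
definitions; nothing here takes a side on [IUTchIII] Cor. 3.12.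
-/

namespace Literature.AnabelianGeometry.SemiGraphs

open CategoryTheory CategoryTheory.Limits CategoryTheory.PreGaloisCategory
open Literature.AnabelianGeometry.Anabelioids

universe v₁ u₁ u

namespace SemiGraphOfAnabelioids

variable {𝒢 𝒢' : SemiGraphOfAnabelioids.{v₁, u₁, u}}

/-! ### The main theorem -/

/-- **The sub-object of `A|_ℍ` attached to a preimage component is connected.**  Let `φ : 𝒢′ → 𝒢`
with the LOCAL data `(cV, cE, position clause)` of `Hom.IsFiniteEtaleCoveringOf φ A`, `ℍ ⊆ 𝔾` a
sub-semi-graph, `K` a preimage component of `φ⁻¹(ℍ)` (`Hom.IsPreimageComponent`), and `m : Z ↪ A|_ℍ` a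
sub-object of `B(𝒢_ℍ)` whose fibre-image at every vertex `w ∈ ℍ` (resp. edge `e ∈ ℍ`) is the union of
the fibre-images of the components `cV w″`, `w″ ∈ K` over `w` (resp. `cE e″`, `e″ ∈ K` over `e`) —
abc-iut-L6-t17's `exists_preimageComponentObject`.  Then `Z` is a CONNECTED object of `B(𝒢_ℍ)`
("a connected component `ℋ″` of `ℋ′`", [SemiAnbd] p. 30).  Sheet argument along the connected `K`.
[cite: MochizukiSemiAnbd2006, Cor. 2.7(i) p.30] -/
theorem isConnected_of_preimageComponent_ranges (φ : Hom 𝒢' 𝒢) (A : 𝒢.BObj)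
    (cV : ∀ v' : 𝒢'.graph.Vertex, π₀Obj (A.S (φ.base.vertexMap v')))
    (cE : ∀ e' : 𝒢'.graph.Edge, π₀Obj (A.T (φ.base.edgeMap e')))
    (hbr : ∀ (b' : 𝒢'.graph.Branch) (v' : 𝒢'.graph.Vertex) (h' : 𝒢'.graph.abuts b' = some v'),
      ∃ f : ((cE (𝒢'.graph.edgeOf b')).1 : 𝒢.E (φ.base.edgeMap (𝒢'.graph.edgeOf b'))) ⟶
          (𝒢.transportE (φ.base.edgeOf_branchMap b')).obj
            ((𝒢.pull (φ.base.branchMap b') (φ.base.vertexMap v')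
              (φ.base.abuts_branchMap b' v' h')).pullback.obj ((cV v').1 : 𝒢.V (φ.base.vertexMap v'))),
        f ≫ (𝒢.transportE (φ.base.edgeOf_branchMap b')).map
              ((𝒢.pull _ _ (φ.base.abuts_branchMap b' v' h')).pullback.map (cV v').1.arrow ≫
                (A.ψ (φ.base.branchMap b') (φ.base.vertexMap v') (φ.base.abuts_branchMap b' v' h')).hom) ≫
            eqToHom (𝒢.transportE_obj_T A (φ.base.edgeOf_branchMap b')) =
          (cE (𝒢'.graph.edgeOf b')).1.arrow)
    (H : 𝒢.graph.Subgraph) (K : 𝒢'.graph.Subgraph) (hK : φ.IsPreimageComponent H K)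
    (Z : (𝒢.restrict H).BObj) (m : Z ⟶ (𝒢.restrictFunctor H).obj A) [Mono m]
    (hmS : ∀ (w : H.toSemiGraph.Vertex) (Fw : 𝒢.V w.1 ⥤ FintypeCat.{v₁}) [FiberFunctor Fw]
        (y : Fw.obj (A.S w.1)),
      y ∈ Set.range (Fw.map (m.fS w)) ↔ ∃ P : π₀Obj (A.S w.1),
        (∃ w'' ∈ K.verts, (⟨φ.base.vertexMap w'', cV w''⟩ : Σ v, π₀Obj (A.S v)) = ⟨w.1, P⟩) ∧
          y ∈ Set.range (Fw.map P.1.arrow))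
    (hmT : ∀ (e : H.toSemiGraph.Edge) (Fe : 𝒢.E e.1 ⥤ FintypeCat.{v₁}) [FiberFunctor Fe]
        (x : Fe.obj (A.T e.1)),
      x ∈ Set.range (Fe.map (m.fT e)) ↔ ∃ Q : π₀Obj (A.T e.1),
        (∃ e'' ∈ K.edges, (⟨φ.base.edgeMap e'', cE e''⟩ : Σ e, π₀Obj (A.T e)) = ⟨e.1, Q⟩) ∧
          x ∈ Set.range (Fe.map Q.1.arrow)) :
    PreGaloisCategory.IsConnected Z := by
  classical
  have hKV : K.verts ⊆ φ.base.vertexMap ⁻¹' H.verts := hK.2.2.2.1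
  have hKE : K.edges ⊆ φ.base.edgeMap ⁻¹' H.edges := hK.2.2.2.2.1
  -- fibre functors of the constituents of `𝒢`
  let FV : ∀ v : 𝒢.graph.Vertex, 𝒢.V v ⥤ FintypeCat.{v₁} := fun v =>
    GaloisCategory.getFiberFunctor (𝒢.V v)
  let FE : ∀ e : 𝒢.graph.Edge, 𝒢.E e ⥤ FintypeCat.{v₁} := fun e =>
    GaloisCategory.getFiberFunctor (𝒢.E e)
  haveI hmS_mono : ∀ w : H.toSemiGraph.Vertex, @Mono (𝒢.V w.1) _ _ _ (m.fS w) := fun w =>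
    (𝒢.restrict H).mono_fS m w
  constructor
  · -- `Z` is not initial: `K` has a vertex `w″`, and the (non-empty) fibre of the component `cV w″`
    -- lies in the fibre of `Z` over `φ w″`
    intro hI
    obtain ⟨w'', hw''⟩ := hK.2.2.1
    let w : H.toSemiGraph.Vertex := ⟨φ.base.vertexMap w'', hKV hw''⟩
    have hρ := ((𝒢.restrict H).hasColimitsOfShape_bObj (J := Discrete PEmpty.{1})).2
    haveI := hρ.1 w
    have hIS : IsInitial (Z.S w) := hI.isInitialObj ((𝒢.restrict H).ρ w) _
    haveI : PreGaloisCategory.IsConnected ((cV w'').1 : 𝒢.V (φ.base.vertexMap w'')) := (cV w'').2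
    obtain ⟨p⟩ := nonempty_fiber_of_isConnected (FV _) ((cV w'').1 : 𝒢.V (φ.base.vertexMap w''))
    have hy : (FV _).map (cV w'').1.arrow p ∈ Set.range ((FV _).map (m.fS w)) :=
      (hmS w (FV _) _).mpr ⟨cV w'', ⟨w'', hw'', rfl⟩, p, rfl⟩
    obtain ⟨z, _⟩ := hy
    exact ((initial_iff_fiber_empty (FV (φ.base.vertexMap w'')) (Z.S w)).mp ⟨hIS⟩).false z
  · intro W j _ hW
    -- the composite sub-object `n : W ↪ Z ↪ A|_ℍ`
    let n : W ⟶ (𝒢.restrictFunctor H).obj A := j ≫ m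
    haveI : Mono n := mono_comp _ _
    haveI hnS_mono : ∀ w : H.toSemiGraph.Vertex, @Mono (𝒢.V w.1) _ _ _ (n.fS w) := fun w =>
      (𝒢.restrict H).mono_fS n w
    haveI hnT_mono : ∀ e : H.toSemiGraph.Edge, @Mono (𝒢.E e.1) _ _ _ (n.fT e) := fun e =>
      (𝒢.restrict H).mono_fT n e
    haveI hjS_mono : ∀ w : H.toSemiGraph.Vertex, @Mono (𝒢.V w.1) _ _ _ (j.fS w) := fun w =>
      (𝒢.restrict H).mono_fS j w
    haveI hjT_mono : ∀ e : H.toSemiGraph.Edge, @Mono (𝒢.E e.1) _ _ _ (j.fT e) := fun e =>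
      (𝒢.restrict H).mono_fT j e
    -- the component predicates: "`cV w″` (resp. `cE e″`) factors through `W`"
    let PV : ∀ w'' : 𝒢'.graph.Vertex, w'' ∈ K.verts → Prop := fun w'' hw'' =>
      ∃ f : ((cV w'').1 : 𝒢.V (φ.base.vertexMap w'')) ⟶ W.S ⟨φ.base.vertexMap w'', hKV hw''⟩,
        f ≫ n.fS ⟨φ.base.vertexMap w'', hKV hw''⟩ = (cV w'').1.arrow
    let PE : ∀ e'' : 𝒢'.graph.Edge, e'' ∈ K.edges → Prop := fun e'' he'' =>
      ∃ g : ((cE e'').1 : 𝒢.E (φ.base.edgeMap e'')) ⟶ W.T ⟨φ.base.edgeMap e'', hKE he''⟩,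
        g ≫ n.fT ⟨φ.base.edgeMap e'', hKE he''⟩ = (cE e'').1.arrow
    -- the branch step: along a branch `b″` of an edge of `K` abutting to a vertex `w″` of `K`
    have hbranch : ∀ (b'' : 𝒢'.graph.Branch) (hb'' : 𝒢'.graph.edgeOf b'' ∈ K.edges)
        (w'' : 𝒢'.graph.Vertex) (hw'' : w'' ∈ K.verts) (hab : 𝒢'.graph.abuts b'' = some w''),
        PE (𝒢'.graph.edgeOf b'') hb'' ↔ PV w'' hw'' := by
      intro b'' hb'' w'' hw'' hab
      have h : 𝒢.graph.abuts (φ.base.branchMap b'') = some (φ.base.vertexMap w'') :=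
        φ.base.abuts_branchMap b'' w'' hab
      have he : 𝒢.graph.edgeOf (φ.base.branchMap b'') = φ.base.edgeMap (𝒢'.graph.edgeOf b'') :=
        φ.base.edgeOf_branchMap b''
      have heH : 𝒢.graph.edgeOf (φ.base.branchMap b'') ∈ H.edges := by
        rw [he]; exact hKE hb''
      obtain ⟨f, hf⟩ := hbr b'' w'' hab
      have hsub := range_subset_of_branchClause A he (FE _)
        ((𝒢.pull _ _ h).pullback.map (cV w'').1.arrow ≫ (A.ψ _ _ h).hom)
        (cE (𝒢'.graph.edgeOf b'')) f hf
      have step := factors_iff_of_gluing_component H A n (φ.base.branchMap b'') heH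
        (φ.base.vertexMap w'') (hKV hw'') h (cV w'') (he ▸ cE (𝒢'.graph.edgeOf b'')) (FE _) hsub
      exact ((factors_eqRec_iff H A n he heH (hKE hb'') (cE (𝒢'.graph.edgeOf b''))).symm.trans
        step.symm).symm.symm
    -- "the component through the node factors through `W`", a predicate on the subdivision of `K`
    let Q : K.toSemiGraph.Node → Prop :=
      Sum.elim (fun v => PV v.1 v.2)
        (Sum.elim (fun e => PE e.1 e.2) (fun b => PE (𝒢'.graph.edgeOf b.1) b.2))
    have hQv : ∀ v : K.toSemiGraph.Vertex, Q (Sum.inl v) ↔ PV v.1 v.2 := fun _ => Iff.rfl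
    have hQe : ∀ e : K.toSemiGraph.Edge, Q (Sum.inr (Sum.inl e)) ↔ PE e.1 e.2 := fun _ => Iff.rfl
    have hQb : ∀ b : K.toSemiGraph.Branch, Q (Sum.inr (Sum.inr b)) ↔ PE (𝒢'.graph.edgeOf b.1) b.2 :=
      fun _ => Iff.rfl
    -- … which is constant along incidences, hence constant (`K` is connected)
    have hrel : ∀ {x y}, K.toSemiGraph.NodeRel x y → (Q x ↔ Q y) := by
      rintro _ _ (⟨b⟩ | ⟨b, v, hbv⟩)
      · exact (hQe _).trans (hQb _).symm
      · exact (hQb _).trans ((hbranch b.1 b.2 v.1 v.2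
          ((SemiGraph.Subgraph.abuts_eq_some_iff K b v).mp hbv)).trans (hQv _).symm)
    have hadj : ∀ {x y}, K.toSemiGraph.subdivision.Adj x y → (Q x ↔ Q y) := fun hxy =>
      ((SemiGraph.subdivision_adj_iff _).mp hxy).elim (fun h => hrel h) (fun h => (hrel h).symm)
    have hwalk : ∀ {x y} (_ : K.toSemiGraph.subdivision.Walk x y), (Q x ↔ Q y) := by
      intro x y p
      induction p with
      | nil => exact Iff.rfl
      | cons hxy _ ih => exact (hadj hxy).trans ih
    have hconst : ∀ x y, (Q x ↔ Q y) := fun x y => by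
      obtain ⟨p⟩ := hK.1.connected.preconnected x y
      exact hwalk p
    -- reading the fibre-image property of `m` at a vertex: a point of the fibre of `W_w` lies under a
    -- component `cV w″`, `w″ ∈ K`, which therefore factors through `W` (lifting lemma)
    have hmeetS : ∀ (w : H.toSemiGraph.Vertex) (y : (FV w.1).obj (W.S w)),
        ∃ (w'' : 𝒢'.graph.Vertex) (hw'' : w'' ∈ K.verts), PV w'' hw'' := by
      rintro ⟨wv, hwv⟩ y
      have hy : (FV wv).map (m.fS ⟨wv, hwv⟩) ((FV wv).map (j.fS ⟨wv, hwv⟩) y) ∈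
          Set.range ((FV wv).map (m.fS ⟨wv, hwv⟩)) := ⟨_, rfl⟩
      obtain ⟨P, ⟨w'', hw''K, hσ⟩, p, hp⟩ := (hmS ⟨wv, hwv⟩ (FV wv) _).mp hy
      have h1 : φ.base.vertexMap w'' = wv := congrArg Sigma.fst hσ
      subst h1
      have hP : cV w'' = P := eq_of_heq (Sigma.mk.inj_iff.mp hσ).2
      subst hP
      haveI : PreGaloisCategory.IsConnected ((cV w'').1 : 𝒢.V (φ.base.vertexMap w'')) := (cV w'').2
      -- the component `n_w`, as a morphism of `𝒢_w` (codomain presented as `A.S w`)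
      let nw : (W.S ⟨φ.base.vertexMap w'', hwv⟩ : 𝒢.V (φ.base.vertexMap w'')) ⟶
          A.S (φ.base.vertexMap w'') := n.fS ⟨φ.base.vertexMap w'', hwv⟩
      haveI : Mono nw := hnS_mono ⟨φ.base.vertexMap w'', hwv⟩
      have e2 : (FV (φ.base.vertexMap w'')).map nw =
          (FV _).map (j.fS ⟨φ.base.vertexMap w'', hwv⟩) ≫ (FV _).map (m.fS ⟨φ.base.vertexMap w'', hwv⟩) :=
        Functor.map_comp _ _ _
      have hy' : (FV (φ.base.vertexMap w'')).map (cV w'').1.arrow p ∈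
          Set.range ((FV _).map nw) := by
        refine ⟨y, ?_⟩
        rw [hp]
        exact (ConcreteCategory.congr_hom e2 y).trans (FintypeCat.comp_apply _ _ y)
      exact ⟨w'', hw''K, @exists_hom_of_map_mem_range _ _ _ (FV (φ.base.vertexMap w'')) _ _ _ _ _
        (cV w'').1.arrow nw ‹Mono nw› p hy'⟩
    have hmeetT : ∀ (e : H.toSemiGraph.Edge) (x : (FE e.1).obj (W.T e)),
        ∃ (e'' : 𝒢'.graph.Edge) (he'' : e'' ∈ K.edges), PE e'' he'' := by
      rintro ⟨ev, hev⟩ x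
      have hx : (FE ev).map (m.fT ⟨ev, hev⟩) ((FE ev).map (j.fT ⟨ev, hev⟩) x) ∈
          Set.range ((FE ev).map (m.fT ⟨ev, hev⟩)) := ⟨_, rfl⟩
      obtain ⟨Q', ⟨e'', he''K, hσ⟩, q, hq⟩ := (hmT ⟨ev, hev⟩ (FE ev) _).mp hx
      have h1 : φ.base.edgeMap e'' = ev := congrArg Sigma.fst hσ
      subst h1
      have hQ' : cE e'' = Q' := eq_of_heq (Sigma.mk.inj_iff.mp hσ).2
      subst hQ'
      haveI : PreGaloisCategory.IsConnected ((cE e'').1 : 𝒢.E (φ.base.edgeMap e'')) := (cE e'').2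
      let ne : (W.T ⟨φ.base.edgeMap e'', hev⟩ : 𝒢.E (φ.base.edgeMap e'')) ⟶
          A.T (φ.base.edgeMap e'') := n.fT ⟨φ.base.edgeMap e'', hev⟩
      haveI : Mono ne := hnT_mono ⟨φ.base.edgeMap e'', hev⟩
      have e2 : (FE (φ.base.edgeMap e'')).map ne =
          (FE _).map (j.fT ⟨φ.base.edgeMap e'', hev⟩) ≫ (FE _).map (m.fT ⟨φ.base.edgeMap e'', hev⟩) :=
        Functor.map_comp _ _ _
      have hx' : (FE (φ.base.edgeMap e'')).map (cE e'').1.arrow q ∈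
          Set.range ((FE _).map ne) := by
        refine ⟨x, ?_⟩
        rw [hq]
        exact (ConcreteCategory.congr_hom e2 x).trans (FintypeCat.comp_apply _ _ x)
      exact ⟨e'', he''K, @exists_hom_of_map_mem_range _ _ _ (FE (φ.base.edgeMap e'')) _ _ _ _ _
        (cE e'').1.arrow ne ‹Mono ne› q hx'⟩
    obtain ⟨x₀⟩ := hK.1.connected.nonempty
    by_cases h0 : Q x₀
    · -- every component factors through `W`: `j` is surjective on fibres, hence an isomorphism
      have hallV : ∀ w'' (hw'' : w'' ∈ K.verts), PV w'' hw'' := fun w'' hw'' =>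
        (hQv ⟨w'', hw''⟩).mp ((hconst _ _).mp h0)
      have hallE : ∀ e'' (he'' : e'' ∈ K.edges), PE e'' he'' := fun e'' he'' =>
        (hQe ⟨e'', he''⟩).mp ((hconst _ _).mp h0)
      have hS : ∀ w : H.toSemiGraph.Vertex, IsIso (j.fS w) := by
        rintro ⟨wv, hwv⟩
        refine isIso_of_mono_of_surjective_fiber (FV wv) (j.fS ⟨wv, hwv⟩) fun z => ?_
        have hz : (FV wv).map (m.fS ⟨wv, hwv⟩) z ∈ Set.range ((FV wv).map (m.fS ⟨wv, hwv⟩)) :=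
          ⟨z, rfl⟩
        obtain ⟨P, ⟨w'', hw''K, hσ⟩, p, hp⟩ := (hmS ⟨wv, hwv⟩ (FV wv) _).mp hz
        have h1 : φ.base.vertexMap w'' = wv := congrArg Sigma.fst hσ
        subst h1
        have hP : cV w'' = P := eq_of_heq (Sigma.mk.inj_iff.mp hσ).2
        subst hP
        obtain ⟨f, hf⟩ := hallV w'' hw''K
        refine ⟨(FV _).map f p, ?_⟩
        apply ConcreteCategory.injective_of_mono_of_preservesPullback
          ((FV _).map (m.fS ⟨φ.base.vertexMap w'', hwv⟩))
        have e1 : (FV (φ.base.vertexMap w'')).map (cV w'').1.arrow =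
            (FV _).map f ≫ (FV _).map (n.fS ⟨φ.base.vertexMap w'', hwv⟩) := by
          rw [← hf]; exact Functor.map_comp _ _ _
        have e2 : (FV (φ.base.vertexMap w'')).map (n.fS ⟨φ.base.vertexMap w'', hwv⟩) =
            (FV _).map (j.fS ⟨φ.base.vertexMap w'', hwv⟩) ≫ (FV _).map (m.fS ⟨φ.base.vertexMap w'', hwv⟩) :=
          Functor.map_comp _ _ _
        rw [← hp, e1, e2]
        exact ((FintypeCat.comp_apply _ _ _).trans (FintypeCat.comp_apply _ _ _)).symm
      have hT : ∀ e : H.toSemiGraph.Edge, IsIso (j.fT e) := by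
        rintro ⟨ev, hev⟩
        refine isIso_of_mono_of_surjective_fiber (FE ev) (j.fT ⟨ev, hev⟩) fun z => ?_
        have hz : (FE ev).map (m.fT ⟨ev, hev⟩) z ∈ Set.range ((FE ev).map (m.fT ⟨ev, hev⟩)) :=
          ⟨z, rfl⟩
        obtain ⟨Q', ⟨e'', he''K, hσ⟩, q, hq⟩ := (hmT ⟨ev, hev⟩ (FE ev) _).mp hz
        have h1 : φ.base.edgeMap e'' = ev := congrArg Sigma.fst hσ
        subst h1
        have hQ' : cE e'' = Q' := eq_of_heq (Sigma.mk.inj_iff.mp hσ).2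
        subst hQ'
        obtain ⟨g, hg⟩ := hallE e'' he''K
        refine ⟨(FE _).map g q, ?_⟩
        haveI : @Mono (𝒢.E (φ.base.edgeMap e'')) _ _ _ (m.fT ⟨φ.base.edgeMap e'', hev⟩) :=
          (𝒢.restrict H).mono_fT m _
        apply ConcreteCategory.injective_of_mono_of_preservesPullback
          ((FE _).map (m.fT ⟨φ.base.edgeMap e'', hev⟩))
        have e1 : (FE (φ.base.edgeMap e'')).map (cE e'').1.arrow =
            (FE _).map g ≫ (FE _).map (n.fT ⟨φ.base.edgeMap e'', hev⟩) := by
          rw [← hg]; exact Functor.map_comp _ _ _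
        have e2 : (FE (φ.base.edgeMap e'')).map (n.fT ⟨φ.base.edgeMap e'', hev⟩) =
            (FE _).map (j.fT ⟨φ.base.edgeMap e'', hev⟩) ≫ (FE _).map (m.fT ⟨φ.base.edgeMap e'', hev⟩) :=
          Functor.map_comp _ _ _
        rw [← hq, e1, e2]
        exact ((FintypeCat.comp_apply _ _ _).trans (FintypeCat.comp_apply _ _ _)).symm
      exact BObj.isIso_of_components j hS hT
    · -- no component factors through `W`: all constituents of `W` have empty fibre, `W` is initial
      have hnoV : ∀ w'' (hw'' : w'' ∈ K.verts), ¬ PV w'' hw'' := fun w'' hw'' hP =>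
        h0 ((hconst _ _).mpr ((hQv ⟨w'', hw''⟩).mpr hP))
      have hnoE : ∀ e'' (he'' : e'' ∈ K.edges), ¬ PE e'' he'' := fun e'' he'' hP =>
        h0 ((hconst _ _).mpr ((hQe ⟨e'', he''⟩).mpr hP))
      have hS : ∀ w : H.toSemiGraph.Vertex, Nonempty (IsInitial (W.S w)) := by
        intro w
        refine (initial_iff_fiber_empty (FV w.1) (W.S w)).mpr ⟨fun y => ?_⟩
        obtain ⟨w'', hw''K, hPV⟩ := hmeetS w y
        exact hnoV w'' hw''K hPV
      have hT : ∀ e : H.toSemiGraph.Edge, Nonempty (IsInitial (W.T e)) := by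
        intro e
        refine (initial_iff_fiber_empty (FE e.1) (W.T e)).mpr ⟨fun x => ?_⟩
        obtain ⟨e'', he''K, hPE⟩ := hmeetT e x
        exact hnoE e'' he''K hPE
      obtain ⟨hI⟩ := BObj.nonempty_isInitial_of_components W hS hT
      exact (hW hI).elim

end SemiGraphOfAnabelioids

end Literature.AnabelianGeometry.SemiGraphs
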